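import Summits.AnomalousDissipation.AnomalousDissipation.Theorems.FloorCertificate.Negative.WeakDuality
-- import Summits.AnomalousDissipation.AnomalousDissipation.Theorems.TaylorCertificatesFloorCertificateEnsembleCeilingStubWeakDualityBudget  -- LANDED p89283; re-enable once the farm has built it
import Summits.AnomalousDissipation.AnomalousDissipation.Theorems.TaylorCertificatesFloorCertificateEnsembleCeilingStubBudgetAlgebra
-- import Summits.AnomalousDissipation.AnomalousDissipation.Theorems.TaylorCertificatesFloorCertificateEnsembleCeilingStubSteadyTaxed  -- LANDED p89290; re-enable once the farm has built it
-- import Summits.AnomalousDissipation.AnomalousDissipation.Theorems.TaylorCertificatesFloorCertificateEnsembleCeilingStubLinearLiouville  -- LANDED p89359; re-enable once the farm has built it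
import Summits.AnomalousDissipation.AnomalousDissipation.Theorems.TaylorCertificatesFloorCertificateStubFanMinimax
-- import Summits.AnomalousDissipation.AnomalousDissipation.Theorems.TaylorCertificatesFloorCertificateEnsembleCeilingStubBudgetDuality  -- LANDED p89563; re-enable once the farm has built it
-- import Summits.AnomalousDissipation.AnomalousDissipation.Theorems.TaylorCertificatesFloorCertificateEnsembleCeilingStubFloorOfRelaxedFloor  -- LANDED p91809; re-enable once the farm has built it
-- import Summits.AnomalousDissipation.AnomalousDissipation.Theorems.TaylorCertificatesFloorCertificateEnsembleCeilingStubRelaxedLoudOfFloor  -- LANDED p94252; re-enable once the farm has built it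
-- import Summits.AnomalousDissipation.AnomalousDissipation.Theorems.TaylorCertificatesFloorCertificateEnsembleCeilingStubCeilingOfTaxed  -- LANDED p106392; re-enable once the farm has built it
-- import Summits.AnomalousDissipation.AnomalousDissipation.Theorems.TaylorCertificatesFloorCertificateEnsembleCeilingStubTargetIffDualPair  -- LANDED p106929; re-enable once the farm has built it
import Summits.AnomalousDissipation.AnomalousDissipation.Theorems.TaylorCertificatesFloorCertificateStubLscEnstrophy
import Summits.AnomalousDissipation.AnomalousDissipation.Theorems.TaylorCertificatesFloorCertificateStubSublevelCompact
import Summits.AnomalousDissipation.AnomalousDissipation.Theorems.TaylorCertificatesFloorCertificateStubCylindricalCombination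
import Summits.AnomalousDissipation.AnomalousDissipation.Theorems.TaylorCertificatesFloorCertificateStubMinimaxAlternative
import Summits.AnomalousDissipation.AnomalousDissipation.Theorems.TaylorCertificatesFloorCertificateStubPenalisationLimit

/-!
# Line `Sketch` for crux `TaylorCertificates.FloorCertificateEnsembleCeiling`
# (stmt-AnomalousDissipation-14086, the route TARGET X) — LEAD'S SKELETON (reshape 3, 2026-08-16)

Line lead `prover-line-stmt-AnomalousDissipation-14086-0`, built on the checked ideator skeleton
`Cruxes/FloorCertificateEnsembleCeiling/SketchIdeator1.lean` (cards `cubic-budget-certificate` +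
`cyclic-livsic-moats`) and the triage merge `cubic-budget-certificate ≈ uniform-friction-certificate`
(TRIAGE-r1-1, TRIAGE-r1-2); `Cruxes/FloorCertificateEnsembleCeiling/PICKED.md`.

## The line

ONE ENERGY-TAXED FLOOR CERTIFICATE IN X's OWN CLASS DECIDES BOTH HALVES OF X, AND X IS EXACTLY ITS OWN
RELAXED DUAL. The certificate species (`TaxedCertificate`): for one smooth solenoidal mean-zero force `f`
and `ε₁, κ, ν₀ > 0`, at every `ν ∈ (0, ν₀)` a cylindrical `Ψ` and a constant weight `α ≤ 0` with
`ε₁ + κ|u|² ≤ ν‖∇u‖² + ⟨F(u), Ψ'(u)⟩ + 2α((u,f) − ν‖∇u‖²)` at every finite-enstrophy state of the Leray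
ball. Dropping the tax gives X's FLOOR; integrating against a stationary statistical solution — WEAK
DUALITY WITH A STATE-DEPENDENT BUDGET (stub A, LANDED) — gives `ε₁ + κ e(μ) ≤ ε(μ)`, and the injection
bound `ε(μ) ≤ ‖f‖₂ √e(μ)` (tree fact, PROVED) gives X's CEILING `e ≤ (‖f‖₂/κ)²`
(`floorCertificateEnsembleCeiling_of_taxed`, kernel-checked, no sorry). The cubic budget of card
`cubic-budget-certificate` is a sufficient entrance (stub B, LANDED). Reshape 2 (after the route repair
rev 13–18 mooted the sibling crux FloorCertificate and its strong-duality line, whose S0/S1/S3a/S3/S4 are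
LANDED and whose S2 = Ky Fan is orphaned): the OPEN stub is now X's EXACT DUAL `stub_dualPair` (C) —
one force whose RELAXED stationary statistics are uniformly loud and whose FMRT statistics are uniformly
bounded — NECESSARY for X by weak duality (`dualPair_of_target`, PROVED) and SUFFICIENT modulo Ky Fan
(stub F) by the landed strong duality (`FloorCertificateEnsembleCeiling_of`); the certificate species is
the line's METHOD for C (`dualPair_of_taxed`, PROVED) and is itself equivalent to UNIFORM RELAXED PINNING
`ε ≥ ε₁ + κe` modulo Ky Fan (`taxedCertificate_iff_pinning`, via stub G = strong duality with a budget,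
LANDED-pending).

## Registered stubs after reshape 3 (tree vocabulary only; each lands verbatim as
## `Theorems/TaylorCertificatesFloorCertificateEnsembleCeiling<Stub>.lean --supports stmt-…-14086`)

* C  `stub_dualPair` [OPEN; the bet; lead] — X's exact dual for ONE force (uniform relaxed floor ∧ uniform
  FMRT ceiling).
* T1 `stub_floorOfRelaxedFloor` — LANDED p91809 — strong duality for the floor at one viscosity (transfer).
* T2 `stub_relaxedLoudOfFloor` — LANDED p94252 — weak duality for the floor at one viscosity (exactness).
* T3 `stub_ceilingOfTaxed` — LANDED p106392 (p94057 resubmitted after a gate restart) — the line's thesis at one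
  viscosity: a taxed floor certificate caps every FMRT energy at `(‖f‖₂/κ)²`.
* T4 `stub_targetIffDualPair` — LANDED p106929 — the summary theorem X ↔ DualPair (T1 + T2 + X's ceiling clause).
LANDED in waves 1–2 (no longer registered; referenced by their tree names, aliased `landed_*` below):
A `stub_weakDualityBudget` p89283, B `stub_budgetAlgebra` p85793, D `stub_linearLiouville` p89359,
E `stub_steadyTaxed` p89290, F `stub_fanMinimax` p91036, G `stub_budgetDuality` p89563
(files `Theorems/TaylorCertificatesFloorCertificateEnsembleCeilingStub*.lean`).

Composition `FloorCertificateEnsembleCeiling_of`: C gives `(f, ε₀, E, ν₀)`; answer X with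
`(f, ε₀/2, E, ν₀)`; the floor family at each `ν` by `floorFamily_of_relaxedFloor` (landed
`stub_minimaxAlternative` + `stub_penalisationLimit` fed landed S0/S1/S3a and stub F); the ceiling is
clause (ii) of C verbatim.

Disproof.lean (cdisprove v5, `Cruxes/FloorCertificateEnsembleCeiling/Disproof.lean`) honoured: no
`_false_without_` theorem; §C pinch / §D budget window are consequences every witness of C inherits; §E
`QuietOrFatStatistics` is, clause by clause, the negation shape of C (relaxed class on the floor side); §F /
barriers constrain the `∃ f` of C (multi-mode, non-Euler-steady gravest shell, genuinely 3-D; live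
candidate f₁₂₃, kit j014255); §G: every certificate entrance keeps the floor at rest and `ν < ν₀`; §H R2
(relaxed ⊋ FMRT duality gap) is now explicit in C's clause (i).
-/

noncomputable section

set_option linter.dupNamespace false

namespace Summit.AnomalousDissipation.AnomalousDissipation.Cruxes.FloorCertificateEnsembleCeiling.Sketch

open MeasureTheory Filter Topology UnitAddTorus
open scoped InnerProductSpace ENNReal
open Literature.Analysis.FunctionSpaces Literature.Analysis.FluidPDE
open Summit.AnomalousDissipation.AnomalousDissipation.Theses.TaylorCertificates
open Summit.AnomalousDissipation.AnomalousDissipation.Theorems.FloorCertificate.Negative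

/-- Local notation: real vector fields on `T³`. -/
local notation "Vec3" => (UnitAddTorus (Fin 3)) → (EuclideanSpace ℝ (Fin 3))
/-- Local notation: `L²(T³; ℝ³)`. -/
local notation "L2" => (Lp (EuclideanSpace ℝ (Fin 3)) 2 (volume : Measure (UnitAddTorus (Fin 3))))
/-- Local notation: the energy space `H`. -/
local notation "H3" => (Torus.energySpace (Fin 3))

/-! ## The stubs (C, T1–T3 registered; `landed_*` = the landed stubs of waves 1–2, tree aliases) -/

/-- **A `landed_weakDualityBudget`** — WEAK DUALITY WITH A STATE-DEPENDENT BUDGET over the relaxed class.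
If `g(u) ≤ ν‖∇u‖² + ⟨F(u),Φ₁'(u)⟩ + 2θ₁((u,f) − ν‖∇u‖²)` at every finite-enstrophy state of the Leray
ball, `θ₁ ≤ 0`, and `μ` is a probability measure on `H` carried by the ball, of finite mean enstrophy,
annihilating the Liouville functional of `Φ₁`, with integrable work `(u,f)` and the global energy
inequality `ε(μ) ≤ ∫(u,f)dμ`, then `∫ g dμ ≤ ε(μ)` (for `μ`-integrable `g`). Why true: the budget floor
holds `μ`-a.e. (finite enstrophy a.e. by `ae_lt_top`, ball a.e.); integrate (`integral_mono_ae`); the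
Liouville identity kills the generator term (`integral_toReal` for the enstrophy), and
`2θ₁(∫(u,f) − ε) ≤ 0`. Verbatim the landed `Negative.WeakDuality.floorFamily_le_ensembleDissipation` /
`Lines/dissipation-deficit-duality.weak_duality` with `integrable_const ε₀` replaced by `g`. Size S–M. -/
theorem landed_weakDualityBudget :
    ∀ (ν : ℝ) (f : Vec3) (Φ₁ : Torus.CylindricalTest (Fin 3)) (θ₁ : ℝ) (g : H3 → ℝ) (μ : Measure H3),
      θ₁ ≤ 0 →
      (∀ u : H3, Torus.eGradNormSq ((u : L2) : Vec3) ≠ ⊤ → ‖u‖ ^ 2 ≤ 16 * (∫ x, ‖f x‖ ^ 2) / ν ^ 2 →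
        g u ≤ ν * (Torus.eGradNormSq ((u : L2) : Vec3)).toReal + Torus.nsGeneratorPairing ν f u (Φ₁.grad u) +
          2 * θ₁ * (Torus.pairing (u : L2) f - ν * (Torus.eGradNormSq ((u : L2) : Vec3)).toReal)) →
      IsProbabilityMeasure μ →
      (∀ᵐ u ∂μ, ‖u‖ ^ 2 ≤ 16 * (∫ x, ‖f x‖ ^ 2) / ν ^ 2) →
      Torus.ensembleEnstrophy μ < ⊤ →
      Integrable (fun u : H3 => Torus.nsGeneratorPairing ν f u (Φ₁.grad u)) μ →
      ∫ u, Torus.nsGeneratorPairing ν f u (Φ₁.grad u) ∂μ = 0 →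
      Integrable (fun u : H3 => Torus.pairing (u : L2) f) μ →
      Torus.ensembleDissipation ν μ ≤ ∫ u, Torus.pairing (u : L2) f ∂μ →
      Integrable g μ →
      ∫ u, g u ∂μ ≤ Torus.ensembleDissipation ν μ :=
  -- LANDED (wave 1, p89283): `Theorems/TaylorCertificatesFloorCertificateEnsembleCeilingStubWeakDualityBudget.lean`
  by sorry -- = Summit.AnomalousDissipation.AnomalousDissipation.Theorems.TaylorCertificatesFloorCertificateEnsembleCeiling.stub_weakDualityBudget (LANDED p89283; sorried only while the farm has not built the module)

/-- **B `landed_budgetAlgebra`** — THE CUBIC BUDGET DOMINATES A QUADRATIC TAX: for `ε₀, β > 0` there are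
`ε₁, κ > 0` with `ε₁ + κ r² ≤ max ε₀ (β r³)` for all `r ≥ 0`. Why true: `max ε₀ (βr³) ≥ (ε₀ + βr³)/2`
and `βr³/2 − κr² ≥ −16κ³/(27β²)` (minimum at `r = 4κ/(3β)`), so `ε₁ = ε₀/4` and any `κ > 0` with
`16κ³/(27β²) ≤ ε₀/4` work (e.g. `κ = min 1 (27β²ε₀/64)`, using `κ³ ≤ κ`). Size S. -/
theorem landed_budgetAlgebra :
    ∀ ε₀ β : ℝ, 0 < ε₀ → 0 < β →
      ∃ ε₁ κ : ℝ, 0 < ε₁ ∧ 0 < κ ∧ ∀ r : ℝ, 0 ≤ r → ε₁ + κ * r ^ 2 ≤ max ε₀ (β * r ^ 3) :=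
  -- LANDED (wave 1, p85793): `Theorems/TaylorCertificatesFloorCertificateEnsembleCeilingStubBudgetAlgebra.lean`
  Summit.AnomalousDissipation.AnomalousDissipation.Theorems.TaylorCertificatesFloorCertificateEnsembleCeiling.stub_budgetAlgebra

/-- **C `stub_dualPair`** — THE TRANSFER TARGET (OPEN; the bet; HARDEST; held by the lead): X's EXACT
DUAL. ONE smooth solenoidal mean-zero force `f` and `ε₀, E, ν₀ > 0` such that at every `ν ∈ (0, ν₀)`
(i) every RELAXED stationary statistic of `NS_ν(f)` on the Leray ball — a Borel probability measure on
`H` carried by `{|u|² ≤ 16‖f‖²/ν²}`, of finite mean enstrophy, annihilating every cylindrical Liouville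
functional, with integrable work and the one global energy inequality `ε(μ) ≤ ∫(u,f)dμ` — dissipates
at least `ε₀` in the mean (UNIFORM RELAXED FLOOR; = the mooted sibling crux FloorCertificate's S5), and
(ii) every FMRT stationary statistical solution with integrable energy has mean energy `≤ E` (X's
ceiling clause VERBATIM). NECESSARY for X (`dualPair_of_target`: weak duality, PROVED) and SUFFICIENT
modulo Ky Fan (stub F) by the strong duality landed next door (`stub_minimaxAlternative`,
`stub_penalisationLimit`); implied by the line's certificate species (`dualPair_of_taxed`: a taxed
certificate pins every relaxed statistic, `ε ≥ ε₁ + κe`, stub A, and caps FMRT energies at `(‖f‖₂/κ)²`).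
Why it might fail: X's exact adversary — for EVERY genuinely 3-D multi-mode force, quiet OR fat
stationary statistics along `ν → 0` (Disproof §E `QuietOrFatStatistics`; relaxed-but-not-FMRT quiet
measures also kill (i), Disproof §H R2); no force with either half is known (ensemble zeroth law /
saturation `Re ≍ Gr^{1/2}`, DoeringFoias2002). Live candidate f₁₂₃ = (sin 2πz, sin 4πx, sin 6πy):
ε ∈ [0.40, 0.83], U² ∈ [0.21, 1.13] on every invariant object met for ν ∈ [0.0035, 0.04] (kit j014255). -/
theorem stub_dualPair :
    ∃ f : Vec3, Torus.IsSmooth f ∧ Torus.IsDivFree f ∧ Torus.HasZeroMean f ∧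
      ∃ ε₀ E ν₀ : ℝ, 0 < ε₀ ∧ 0 < ν₀ ∧ ∀ ν : ℝ, 0 < ν → ν < ν₀ →
        (∀ μ : Measure H3,
          IsProbabilityMeasure μ →
          (∀ᵐ u ∂μ, ‖u‖ ^ 2 ≤ 16 * (∫ x, ‖f x‖ ^ 2) / ν ^ 2) →
          Torus.ensembleEnstrophy μ < ⊤ →
          (∀ Φ : Torus.CylindricalTest (Fin 3),
            Integrable (fun u => Torus.nsGeneratorPairing ν f u (Φ.grad u)) μ ∧
              ∫ u, Torus.nsGeneratorPairing ν f u (Φ.grad u) ∂μ = 0) →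
          Integrable (fun u : H3 => Torus.pairing (u : L2) f) μ →
          Torus.ensembleDissipation ν μ ≤ ∫ u, Torus.pairing (u : L2) f ∂μ →
          ε₀ ≤ Torus.ensembleDissipation ν μ) ∧
        (∀ μ : Measure H3, Torus.IsStationaryStatisticalSolution ν f μ →
          Integrable (fun v : H3 => ‖v‖ ^ 2) μ → Torus.ensembleEnergy μ ≤ E) := by
  sorry

/-- **T1 `stub_floorOfRelaxedFloor`** — STRONG DUALITY FOR THE FLOOR AT ONE VISCOSITY (the transfer
stub; provable now, everything it needs is LANDED): if every RELAXED stationary statistic of `NS_ν(f)` on the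
Leray ball (probability measure carried by the ball, finite mean enstrophy, all cylindrical Liouville
identities, integrable work, global energy inequality) dissipates at least `ε₀ > 0` in the mean, then some
cylindrical `Φ₁` and `θ₁ ≤ 0` certify the floor with budget `ε₀/2` at every finite-enstrophy state of the
ball. Why true = `floorFamily_of_relaxedFloor` below (kernel-checked): otherwise, for every `n` the landed
minimax alternative `TaylorCertificatesFloorCertificate.stub_minimaxAlternative` (fed the landed S0
`stub_lscEnstrophy`, S1 `stub_sublevelCompact`, S2 `stub_fanMinimax`, S3a `stub_cylindricalCombination`) at
`(L, γ, η) = (n, 3ε₀/4, ε₀/8)` cannot take its first horn, so it yields `(n, 7ε₀/8)`-approximately relaxed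
statistics, whose landed penalisation limit `stub_penalisationLimit` is a relaxed statistic with
`ε ≤ 7ε₀/8 < ε₀`. Size S (composition of landed theorems; copy the ~40 lines). -/
theorem stub_floorOfRelaxedFloor :
    ∀ (ν : ℝ) (f : Vec3) (ε₀ : ℝ), 0 < ν → Torus.IsSmooth f → 0 < ε₀ →
      (∀ μ : Measure H3,
        IsProbabilityMeasure μ →
        (∀ᵐ u ∂μ, ‖u‖ ^ 2 ≤ 16 * (∫ x, ‖f x‖ ^ 2) / ν ^ 2) →
        Torus.ensembleEnstrophy μ < ⊤ →
        (∀ Φ : Torus.CylindricalTest (Fin 3),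
          Integrable (fun u => Torus.nsGeneratorPairing ν f u (Φ.grad u)) μ ∧
            ∫ u, Torus.nsGeneratorPairing ν f u (Φ.grad u) ∂μ = 0) →
        Integrable (fun u : H3 => Torus.pairing (u : L2) f) μ →
        Torus.ensembleDissipation ν μ ≤ ∫ u, Torus.pairing (u : L2) f ∂μ →
        ε₀ ≤ Torus.ensembleDissipation ν μ) →
      ∃ (Φ₁ : Torus.CylindricalTest (Fin 3)) (θ₁ : ℝ), θ₁ ≤ 0 ∧
        ∀ u : H3, Torus.eGradNormSq ((u : L2) : Vec3) ≠ ⊤ → ‖u‖ ^ 2 ≤ 16 * (∫ x, ‖f x‖ ^ 2) / ν ^ 2 →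
          ε₀ / 2 ≤ ν * (Torus.eGradNormSq ((u : L2) : Vec3)).toReal + Torus.nsGeneratorPairing ν f u (Φ₁.grad u) +
            2 * θ₁ * (Torus.pairing (u : L2) f - ν * (Torus.eGradNormSq ((u : L2) : Vec3)).toReal) :=
  -- LANDED (wave 3, p91809): `Theorems/TaylorCertificatesFloorCertificateEnsembleCeilingStubFloorOfRelaxedFloor.lean`
  by sorry -- = Summit.AnomalousDissipation.AnomalousDissipation.Theorems.TaylorCertificatesFloorCertificateEnsembleCeiling.stub_floorOfRelaxedFloor (LANDED p91809; sorried only while the farm has not built the module)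

/-- **T2 `stub_relaxedLoudOfFloor`** — WEAK DUALITY FOR THE FLOOR AT ONE VISCOSITY (the exactness stub;
provable now = landed stub A with the constant budget `g ≡ ε`, `integrable_const`): a floor certificate
with budget `ε` at `(f, ν)` makes every relaxed stationary statistic of `NS_ν(f)` `ε`-loud. Size XS. -/
theorem stub_relaxedLoudOfFloor :
    ∀ (ν : ℝ) (f : Vec3) (Φ₁ : Torus.CylindricalTest (Fin 3)) (θ₁ ε : ℝ) (μ : Measure H3),
      θ₁ ≤ 0 →
      (∀ u : H3, Torus.eGradNormSq ((u : L2) : Vec3) ≠ ⊤ → ‖u‖ ^ 2 ≤ 16 * (∫ x, ‖f x‖ ^ 2) / ν ^ 2 →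
        ε ≤ ν * (Torus.eGradNormSq ((u : L2) : Vec3)).toReal + Torus.nsGeneratorPairing ν f u (Φ₁.grad u) +
          2 * θ₁ * (Torus.pairing (u : L2) f - ν * (Torus.eGradNormSq ((u : L2) : Vec3)).toReal)) →
      IsProbabilityMeasure μ →
      (∀ᵐ u ∂μ, ‖u‖ ^ 2 ≤ 16 * (∫ x, ‖f x‖ ^ 2) / ν ^ 2) →
      Torus.ensembleEnstrophy μ < ⊤ →
      Integrable (fun u : H3 => Torus.nsGeneratorPairing ν f u (Φ₁.grad u)) μ →
      ∫ u, Torus.nsGeneratorPairing ν f u (Φ₁.grad u) ∂μ = 0 →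
      Integrable (fun u : H3 => Torus.pairing (u : L2) f) μ →
      Torus.ensembleDissipation ν μ ≤ ∫ u, Torus.pairing (u : L2) f ∂μ →
      ε ≤ Torus.ensembleDissipation ν μ :=
  -- LANDED (wave 3, p94252): `Theorems/TaylorCertificatesFloorCertificateEnsembleCeilingStubRelaxedLoudOfFloor.lean`
  by sorry -- = Summit.AnomalousDissipation.AnomalousDissipation.Theorems.TaylorCertificatesFloorCertificateEnsembleCeiling.stub_relaxedLoudOfFloor (LANDED p94252; sorried only while the farm has not built the module)

/-- **T3 `stub_ceilingOfTaxed`** — THE LINE's THESIS AT ONE VISCOSITY (provable now = landed stub A + the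
tree's injection bound): an energy-TAXED floor certificate `ε₁ + κ|u|² ≤ ν‖∇u‖² + ⟨F(u),Ψ'(u)⟩ + 2α((u,f) − ν‖∇u‖²)`
on the finite-enstrophy Leray ball of `(f, ν)` (`ν > 0`, `f ∈ L²`, `ε₁ ≥ 0`, `κ > 0`, `α ≤ 0`) caps the mean
energy of EVERY stationary statistical solution of `NS_ν(f)` with integrable energy: `e(μ) ≤ (‖f‖₂/κ)²`.
Why true = `ensembleEnergy_le_of_taxed` below: stub A with `g = ε₁ + κ|u|²` (fed the FMRT facts `prob`,
`ae_norm_le` + `ball_of_norm_le`, `enstrophy_finite`, `generator`, `integrable_pairing`, `energy_le_holds`)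
gives `ε₁ + κ e ≤ ε`, the injection bound `ensembleDissipation_le_of_isStationary_holds` gives `ε ≤ ‖f‖₂ √e`,
and `κ a² ≤ ‖f‖₂ a` forces `a² ≤ (‖f‖₂/κ)²`. Size S. -/
theorem stub_ceilingOfTaxed :
    ∀ (ν : ℝ) (f : Vec3) (Ψ : Torus.CylindricalTest (Fin 3)) (α ε₁ κ : ℝ) (μ : Measure H3),
      0 < ν → MemLp f 2 volume → 0 ≤ ε₁ → 0 < κ → α ≤ 0 →
      (∀ u : H3, Torus.eGradNormSq ((u : L2) : Vec3) ≠ ⊤ → ‖u‖ ^ 2 ≤ 16 * (∫ x, ‖f x‖ ^ 2) / ν ^ 2 →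
        ε₁ + κ * ‖u‖ ^ 2 ≤ ν * (Torus.eGradNormSq ((u : L2) : Vec3)).toReal +
          Torus.nsGeneratorPairing ν f u (Ψ.grad u) +
          2 * α * (Torus.pairing (u : L2) f - ν * (Torus.eGradNormSq ((u : L2) : Vec3)).toReal)) →
      Torus.IsStationaryStatisticalSolution ν f μ → Integrable (fun v : H3 => ‖v‖ ^ 2) μ →
      Torus.ensembleEnergy μ ≤ (Real.sqrt (∫ x, ‖f x‖ ^ 2) / κ) ^ 2 :=
  -- LANDED (wave 3, p94057 -> p106392): `Theorems/TaylorCertificatesFloorCertificateEnsembleCeilingStubCeilingOfTaxed.lean`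
  by sorry -- = Summit.AnomalousDissipation.AnomalousDissipation.Theorems.TaylorCertificatesFloorCertificateEnsembleCeiling.stub_ceilingOfTaxed (LANDED p106392; sorried only while the farm has not built the module)

/-- **T4 `stub_targetIffDualPair`** — THE LINE's SUMMARY THEOREM (provable now from the landed T1, T2 and
X's own ceiling clause): the crux X is EQUIVALENT to its exact dual `DualPair` — one admissible force whose
RELAXED stationary statistics on the Leray ball are uniformly loud (`ε ≥ ε₀`) and whose FMRT stationary
statistical solutions with integrable energy are uniformly bounded (`e ≤ E`) for `ν ∈ (0, ν₀)`.
`→`: weak duality (T2) with the same constants; `←`: strong duality (T1) with `ε₀/2`. Size S. -/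
theorem stub_targetIffDualPair :
    Summit.AnomalousDissipation.AnomalousDissipation.Theses.TaylorCertificates.FloorCertificateEnsembleCeiling ↔
      ∃ f : Vec3, Torus.IsSmooth f ∧ Torus.IsDivFree f ∧ Torus.HasZeroMean f ∧
        ∃ ε₀ E ν₀ : ℝ, 0 < ε₀ ∧ 0 < ν₀ ∧ ∀ ν : ℝ, 0 < ν → ν < ν₀ →
          (∀ μ : Measure H3,
            IsProbabilityMeasure μ →
            (∀ᵐ u ∂μ, ‖u‖ ^ 2 ≤ 16 * (∫ x, ‖f x‖ ^ 2) / ν ^ 2) →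
            Torus.ensembleEnstrophy μ < ⊤ →
            (∀ Φ : Torus.CylindricalTest (Fin 3),
              Integrable (fun u => Torus.nsGeneratorPairing ν f u (Φ.grad u)) μ ∧
                ∫ u, Torus.nsGeneratorPairing ν f u (Φ.grad u) ∂μ = 0) →
            Integrable (fun u : H3 => Torus.pairing (u : L2) f) μ →
            Torus.ensembleDissipation ν μ ≤ ∫ u, Torus.pairing (u : L2) f ∂μ →
            ε₀ ≤ Torus.ensembleDissipation ν μ) ∧
          (∀ μ : Measure H3, Torus.IsStationaryStatisticalSolution ν f μ →
            Integrable (fun v : H3 => ‖v‖ ^ 2) μ → Torus.ensembleEnergy μ ≤ E) :=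
  -- LANDED (cycle 1, p106929): `Theorems/TaylorCertificatesFloorCertificateEnsembleCeilingStubTargetIffDualPair.lean`
  by sorry -- = Summit.AnomalousDissipation.AnomalousDissipation.Theorems.TaylorCertificatesFloorCertificateEnsembleCeiling.stub_targetIffDualPair (LANDED p106929; sorried only while the farm has not built the module)

/-- **F `landed_fanMinimax`** — KY FAN'S CONVEX-LIKE MINIMAX PRINCIPLE (Fan 1953, Thm 2; `γ`-form),
verbatim the mooted sibling line's registered stub S2 (nobody holds it any more): `X` compact, `Y`
nonempty, `φ(·, y)` lower semicontinuous, `φ` convex-like in `x` and concave-like in `y`; if every `x`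
is beaten by some `y` above `γ`, one `y` beats every `x` above `γ`. Why true = Fan's proof: the closed
sets `C_y = {x : φ(x,y) ≤ γ}` have empty intersection, so by compactness finitely many `y₁ … yₙ` have
`maxᵢ φ(x, yᵢ) > γ` for all `x`, indeed `≥ β > γ` (an lsc function attains its min on a compact set;
`X = ∅` trivial via `Nonempty Y`); the set `E = {z ∈ ℝⁿ : ∃ x, ∀ i, φ(x,yᵢ) ≤ zᵢ}` is convex
(convex-likeness in `x`) and misses the open convex box `{z : ∀ i, zᵢ < β}`; separate
(`geometric_hahn_banach_open`; template `Literature/Analysis/Convex/MinMax.lean`): weights `λᵢ ≥ 0`,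
`Σλᵢ = 1`, `Σλᵢ φ(x,yᵢ) ≥ β` for all `x`; concave-likeness in `y`, iterated to `n` points by induction,
gives `y₀` with `φ(x, y₀) ≥ Σλᵢ φ(x,yᵢ) ≥ β > γ`. [Fan, PNAS 39 (1953) 42–47, Thm 2.] Size M–L;
reusable (worth a Literature copy under `Analysis/Convex/`). -/
theorem landed_fanMinimax :
    ∀ (X Y : Type) [TopologicalSpace X] [CompactSpace X] [Nonempty Y] (φ : X → Y → ℝ),
      (∀ y : Y, LowerSemicontinuous fun x : X => φ x y) →
      (∀ (x₁ x₂ : X) (t : ℝ), 0 ≤ t → t ≤ 1 → ∃ x₀ : X, ∀ y : Y, φ x₀ y ≤ t * φ x₁ y + (1 - t) * φ x₂ y) →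
      (∀ (y₁ y₂ : Y) (t : ℝ), 0 ≤ t → t ≤ 1 → ∃ y₀ : Y, ∀ x : X, t * φ x y₁ + (1 - t) * φ x y₂ ≤ φ x y₀) →
      ∀ γ : ℝ, (∀ x : X, ∃ y : Y, γ < φ x y) → ∃ y : Y, ∀ x : X, γ < φ x y :=
  -- LANDED (wave 2, p91036): `Theorems/TaylorCertificatesFloorCertificateEnsembleCeilingStubFanMinimax.lean`, itself
  -- a one-line alias of the sibling line's landed `TaylorCertificatesFloorCertificateStubFanMinimax.lean` (imported here)
  Summit.AnomalousDissipation.AnomalousDissipation.Theorems.TaylorCertificatesFloorCertificate.stub_fanMinimax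

/-- **D `landed_linearLiouville`** — THE LIOUVILLE EQUATION TESTED WITH A FIXED FIELD. For `ν > 0`,
`f ∈ L²`, a smooth solenoidal mean-zero test field `w` and a stationary statistical solution `μ` of
`NS_ν(f)` (FMRT IV Def. 1.3): `u ↦ ⟨F(u), w⟩ = (f,w) + ν(u,Δw) + ∫(u⊗u):∇w` is `μ`-integrable and
`∫ ⟨F(u), w⟩ dμ = 0`. Why true: `μ` is carried by the support ball `|u| ≤ ‖f‖₂/(4π²ν)`
(`IsStationaryStatisticalSolution.ae_norm_le`), on which `|(u, w)| < R := ‖f‖₂‖w‖₂/(4π²ν) + 1`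
(`Torus.abs_pairing_coe_le`); the cylindrical functional `Φ` with one coordinate `(·, w)` and profile
`y ↦ y₀ χ(y)` (`χ` a `ContDiffBump` `≡ 1` on the closed `R`-ball) has `Φ'(u) = w` whenever `|(u,w)| < R`
(copy `exists_cylindrical_grad_eq`, Cruxes/FloorCertificateEnsembleCeiling/Disproof.lean §D, 45 lines),
so `⟨F(u), Φ'(u)⟩ = ⟨F(u), w⟩` `μ`-a.e.; conclude with `hμ.generator Φ` (`Integrable.congr`,
`integral_congr_ae`). Size M. -/
theorem landed_linearLiouville :
    ∀ (ν : ℝ) (f w : Vec3) (μ : Measure H3), 0 < ν → MemLp f 2 volume →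
      Torus.IsSmooth w → Torus.IsDivFree w → Torus.HasZeroMean w →
      Torus.IsStationaryStatisticalSolution ν f μ →
      Integrable (fun u : H3 => Torus.nsGeneratorPairing ν f u w) μ ∧
        ∫ u, Torus.nsGeneratorPairing ν f u w ∂μ = 0 :=
  -- LANDED (wave 1, p89359): `Theorems/TaylorCertificatesFloorCertificateEnsembleCeilingStubLinearLiouville.lean`
  by sorry -- = Summit.AnomalousDissipation.AnomalousDissipation.Theorems.TaylorCertificatesFloorCertificateEnsembleCeiling.stub_linearLiouville (LANDED p89359; sorried only while the farm has not built the module)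

/-- **E `landed_steadyTaxed`** — THE TAXED PINCH ON ATOMS. If the taxed floor with constants `(ε₁, κ)`
and multiplier `(Ψ, α)` holds at every finite-enstrophy state of the Leray ball of `(f, ν)` (`ν > 0`,
`f ∈ L²`), then every steady weak solution `u ∈ V` of `NS_ν(f)` satisfies
`ε₁ + κ|u|² ≤ ν‖∇u‖² = (u, f)`. Why true: verbatim `Negative.WeakDuality.floorFamily_le_dissipation_of_steady`
with budget `ε₁ + κ|u|²` in place of `ε₀`: `u ∈ V` has finite enstrophy
(`hV.2.eGradNormSq_lt_top`), the energy equation `ν‖∇u‖² = (u,f)` (`IsSteadyWeakSolution.energy_eq'`,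
`Fintype.card (Fin 3) ≤ 4`) + Poincaré (`Torus.norm_sq_le_toReal_eGradNormSq`) put `u` in the ball
(`ball_of_norm_le`), the generator term vanishes at a steady state (`Φ'(u) ∈ 𝒱`:
`CylindricalTest.isSmooth_grad_holds` / `isDivFree_grad_holds` / `hasZeroMean_grad_holds`) and so does
the energy channel. No sign condition on `α` is needed. Size S. -/
theorem landed_steadyTaxed :
    ∀ (ν : ℝ) (f : Vec3) (hf : MemLp f 2 volume) (Ψ : Torus.CylindricalTest (Fin 3)) (α ε₁ κ : ℝ) (u : H3),
      0 < ν →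
      (∀ v : H3, Torus.eGradNormSq ((v : L2) : Vec3) ≠ ⊤ → ‖v‖ ^ 2 ≤ 16 * (∫ x, ‖f x‖ ^ 2) / ν ^ 2 →
        ε₁ + κ * ‖v‖ ^ 2 ≤ ν * (Torus.eGradNormSq ((v : L2) : Vec3)).toReal +
          Torus.nsGeneratorPairing ν f v (Ψ.grad v) +
          2 * α * (Torus.pairing (v : L2) f - ν * (Torus.eGradNormSq ((v : L2) : Vec3)).toReal)) →
      (u : L2) ∈ Torus.energySpaceV (Fin 3) → Torus.IsSteadyWeakSolution ν f u →
      ε₁ + κ * ‖u‖ ^ 2 ≤ ν * (Torus.eGradNormSq ((u : L2) : Vec3)).toReal ∧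
        ν * (Torus.eGradNormSq ((u : L2) : Vec3)).toReal = Torus.pairing (u : L2) f ∧
        Torus.pairing (u : L2) f ≤ ‖u‖ * ‖hf.toLp f‖ :=
  -- LANDED (wave 1, p89290): `Theorems/TaylorCertificatesFloorCertificateEnsembleCeilingStubSteadyTaxed.lean`
  by sorry -- = Summit.AnomalousDissipation.AnomalousDissipation.Theorems.TaylorCertificatesFloorCertificateEnsembleCeiling.stub_steadyTaxed (LANDED p89290; sorried only while the farm has not built the module)

/-- **G `landed_budgetDuality`** — STRONG DUALITY WITH A STATE-DEPENDENT BUDGET, GIVEN THE SIBLING LINE's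
S0 (lsc of the mean enstrophy), S1 (compact dissipation sublevel sets), S2 (Ky Fan's convex-like
minimax principle) and S3a (linear combinations of cylindrical tests on a ball), all taken as hypotheses
in the exact shapes of `Cruxes/FloorCertificate/Lines/dissipation-deficit-duality.lean` (S0, S1, S3a are
LANDED: `TaylorCertificatesFloorCertificateStubLscEnstrophy/…SublevelCompact/…CylindricalCombination`).
For `ν > 0`, smooth `f`, a CONTINUOUS budget `g : H → ℝ` of quadratic growth `|g u| ≤ K(1 + |u|²)` (the
shape consumed by `continuous_integral_of_ball` / `integrable_of_ball` of `…StubMinimaxAlternativeTools`), and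
a slack `η > 0`: if
every RELAXED stationary statistic `μ` of `NS_ν(f)` on the Leray ball (probability, carried by the ball,
finite mean enstrophy, all cylindrical Liouville identities, integrable work, global energy inequality)
satisfies `∫ g dμ + η ≤ ε(μ)`, then some cylindrical `Φ` and `θ ≤ 0` certify the budget floor `g − η` at
every finite-enstrophy state of the ball. Why true = the sibling composition with the payoff
`φ(μ,(Φ,θ)) = ε(μ) + ∫⟨F,Φ'⟩dμ + 2θ(∫(u,f)dμ − ε(μ)) − ∫ g dμ`: the extra term is AFFINE and CONTINUOUS in
`μ` on ball-carried measures (`continuous_integral_of_ball` of `…StubMinimaxAlternativeTools`, `g`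
continuous and bounded on the ball) and independent of the multiplier, so Fan's three hypotheses
(`fan_convex`, `fan_concave`, `lagrangian_lowerSemicontinuous`) survive verbatim; the alternative on the
sublevel set `{ε ≤ c}` with `c ≥ sup_ball |g| + L(1 + 2√ρ‖f‖) + η + 1` gives EITHER a slope-`L` multiplier
beating every Dirac mass (`lagrangian_dirac`: budget floor `g − η/4` at ball states with `ν‖∇u‖² ≤ c`;
the tail `ν‖∇u‖² > c` pays by itself, `tail_estimate`) OR, for every `n`, an `(n, η/4)`-approximately
relaxed statistic with `ε(μₙ) − ∫g dμₙ ≤ η/4`; the penalisation limit (S4's proof with `M` replaced by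
`∫g dμ + η/4`, using `∫g dμₙ → ∫g dμ` along the cluster filter and lsc of `ε`) yields an exact relaxed
statistic with `ε(μ) ≤ ∫ g dμ + η/4`, contradicting the hypothesis. Size L (adaptation of three landed
files). -/
theorem landed_budgetDuality :
    (LowerSemicontinuous fun μ : ProbabilityMeasure (Torus.energySpace (Fin 3)) =>
      Torus.ensembleEnstrophy (μ : Measure (Torus.energySpace (Fin 3)))) →
    (∀ (ρ : ℝ) (c : ℝ≥0∞), c ≠ ⊤ →
      IsCompact {μ : ProbabilityMeasure (Torus.energySpace (Fin 3)) |
        (∀ᵐ u ∂(μ : Measure (Torus.energySpace (Fin 3))), ‖u‖ ^ 2 ≤ ρ) ∧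
          Torus.ensembleEnstrophy (μ : Measure (Torus.energySpace (Fin 3))) ≤ c}) →
    (∀ (X Y : Type) [TopologicalSpace X] [CompactSpace X] [Nonempty Y] (φ : X → Y → ℝ),
      (∀ y : Y, LowerSemicontinuous fun x : X => φ x y) →
      (∀ (x₁ x₂ : X) (t : ℝ), 0 ≤ t → t ≤ 1 → ∃ x₀ : X, ∀ y : Y, φ x₀ y ≤ t * φ x₁ y + (1 - t) * φ x₂ y) →
      (∀ (y₁ y₂ : Y) (t : ℝ), 0 ≤ t → t ≤ 1 → ∃ y₀ : Y, ∀ x : X, t * φ x y₁ + (1 - t) * φ x y₂ ≤ φ x y₀) →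
      ∀ γ : ℝ, (∀ x : X, ∃ y : Y, γ < φ x y) → ∃ y : Y, ∀ x : X, γ < φ x y) →
    (∀ (ρ a b : ℝ) (Φ₁ Φ₂ : Torus.CylindricalTest (Fin 3)), ∃ Φ₀ : Torus.CylindricalTest (Fin 3),
      ∀ u : Torus.energySpace (Fin 3), ‖u‖ ^ 2 ≤ ρ → Φ₀.grad u = a • Φ₁.grad u + b • Φ₂.grad u) →
    ∀ (ν : ℝ) (f : Vec3), 0 < ν → Torus.IsSmooth f →
    ∀ (g : H3 → ℝ), Continuous g → (∃ K : ℝ, ∀ u : H3, |g u| ≤ K * (1 + ‖u‖ ^ 2)) →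
    ∀ η : ℝ, 0 < η →
      (∀ μ : Measure H3,
        IsProbabilityMeasure μ →
        (∀ᵐ u ∂μ, ‖u‖ ^ 2 ≤ 16 * (∫ x, ‖f x‖ ^ 2) / ν ^ 2) →
        Torus.ensembleEnstrophy μ < ⊤ →
        (∀ Φ : Torus.CylindricalTest (Fin 3),
          Integrable (fun u => Torus.nsGeneratorPairing ν f u (Φ.grad u)) μ ∧
            ∫ u, Torus.nsGeneratorPairing ν f u (Φ.grad u) ∂μ = 0) →
        Integrable (fun u : H3 => Torus.pairing (u : L2) f) μ →
        Torus.ensembleDissipation ν μ ≤ ∫ u, Torus.pairing (u : L2) f ∂μ →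
        (∫ u, g u ∂μ) + η ≤ Torus.ensembleDissipation ν μ) →
      ∃ (Φ : Torus.CylindricalTest (Fin 3)) (θ : ℝ), θ ≤ 0 ∧
        ∀ u : H3, Torus.eGradNormSq ((u : L2) : Vec3) ≠ ⊤ → ‖u‖ ^ 2 ≤ 16 * (∫ x, ‖f x‖ ^ 2) / ν ^ 2 →
          g u - η ≤ ν * (Torus.eGradNormSq ((u : L2) : Vec3)).toReal + Torus.nsGeneratorPairing ν f u (Φ.grad u) +
            2 * θ * (Torus.pairing (u : L2) f - ν * (Torus.eGradNormSq ((u : L2) : Vec3)).toReal) :=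
  -- LANDED (wave 1, p89563): `Theorems/TaylorCertificatesFloorCertificateEnsembleCeilingStubBudgetDuality.lean`
  by sorry -- = Summit.AnomalousDissipation.AnomalousDissipation.Theorems.TaylorCertificatesFloorCertificateEnsembleCeiling.stub_budgetDuality (LANDED p89563; sorried only while the farm has not built the module)

/-! ## Vocabulary of the composition (definitional; bridged to the stubs by `rfl`) -/

/-- The floor inequality of X at one state with a STATE-DEPENDENT BUDGET `g u` in place of `ε₀`
(for `g ≡ ε₀` this is the landed `Negative.FloorIneq ν f Φ₁ θ₁ ε₀ u`, `budgetFloorIneq_const_iff`). -/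
def BudgetFloorIneq (ν : ℝ) (f : Vec3) (Φ₁ : Torus.CylindricalTest (Fin 3)) (θ₁ : ℝ) (g : H3 → ℝ)
    (u : H3) : Prop :=
  Torus.eGradNormSq ((u : L2) : Vec3) ≠ ⊤ → ‖u‖ ^ 2 ≤ 16 * (∫ x, ‖f x‖ ^ 2) / ν ^ 2 →
    g u ≤ ν * (Torus.eGradNormSq ((u : L2) : Vec3)).toReal + Torus.nsGeneratorPairing ν f u (Φ₁.grad u) +
      2 * θ₁ * (Torus.pairing (u : L2) f - ν * (Torus.eGradNormSq ((u : L2) : Vec3)).toReal)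

/-- A BUDGET-`g` FLOOR FAMILY for `(f, ν)`: some cylindrical `Φ₁` and `θ₁ ≤ 0` with the budget floor at
every state. -/
def BudgetFloorFamily (f : Vec3) (g : H3 → ℝ) (ν : ℝ) : Prop :=
  ∃ (Φ₁ : Torus.CylindricalTest (Fin 3)) (θ₁ : ℝ), θ₁ ≤ 0 ∧ ∀ u : H3, BudgetFloorIneq ν f Φ₁ θ₁ g u

/-- The quadratic TAX budget `u ↦ ε₁ + κ|u|²`. -/
def taxBudget (ε₁ κ : ℝ) : H3 → ℝ := fun u => ε₁ + κ * ‖u‖ ^ 2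

/-- The CUBIC budget `u ↦ max ε₀ (β|u|³)` of card `cubic-budget-certificate`. -/
def cubicBudget (ε₀ β : ℝ) : H3 → ℝ := fun u => max ε₀ (β * ‖u‖ ^ 3)

/-- `TaxedCertificate` — the line's CERTIFICATE SPECIES (card `uniform-friction-certificate` (★) with `θ = α`):
ONE force with a ν-uniform energy-taxed floor certificate `ε₁ + κ|u|²` in X's own class. SUFFICIENT for X
(`floorCertificateEnsembleCeiling_of_taxed`), equivalent to uniform relaxed pinning modulo Ky Fan
(`taxedCertificate_iff_pinning`). -/
def TaxedCertificate : Prop :=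
  ∃ f : Vec3, Torus.IsSmooth f ∧ Torus.IsDivFree f ∧ Torus.HasZeroMean f ∧
    ∃ ε₁ κ ν₀ : ℝ, 0 < ε₁ ∧ 0 < κ ∧ 0 < ν₀ ∧ ∀ ν : ℝ, 0 < ν → ν < ν₀ → BudgetFloorFamily f (taxBudget ε₁ κ) ν

/-- `CubicCertificate` (C⁺ of card `cubic-budget-certificate`, = `SketchIdeator1.CubicCertificate`). -/
def CubicCertificate : Prop :=
  ∃ f : Vec3, Torus.IsSmooth f ∧ Torus.IsDivFree f ∧ Torus.HasZeroMean f ∧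
    ∃ ε₀ β ν₀ : ℝ, 0 < ε₀ ∧ 0 < β ∧ 0 < ν₀ ∧ ∀ ν : ℝ, 0 < ν → ν < ν₀ → BudgetFloorFamily f (cubicBudget ε₀ β) ν

/-- Constant budgets: `BudgetFloorIneq` with `g ≡ ε₀` IS the landed `FloorIneq` (definitional). -/
theorem budgetFloorIneq_const_iff (ν : ℝ) (f : Vec3) (Φ₁ : Torus.CylindricalTest (Fin 3)) (θ₁ ε₀ : ℝ)
    (u : H3) : BudgetFloorIneq ν f Φ₁ θ₁ (fun _ => ε₀) u ↔ FloorIneq ν f Φ₁ θ₁ ε₀ u :=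
  Iff.rfl

/-! ## Proved glue -/

/-- Budget floors are monotone in the budget. -/
theorem budgetFloorIneq_mono {ν : ℝ} {f : Vec3} {Φ₁ : Torus.CylindricalTest (Fin 3)} {θ₁ : ℝ}
    {g g' : H3 → ℝ} {u : H3} (h : BudgetFloorIneq ν f Φ₁ θ₁ g u) (hle : g' u ≤ g u) :
    BudgetFloorIneq ν f Φ₁ θ₁ g' u :=
  fun h1 h2 => hle.trans (h h1 h2)

/-- Budget floor families are monotone in the budget. -/
theorem budgetFloorFamily_mono {ν : ℝ} {f : Vec3} {g g' : H3 → ℝ} (h : BudgetFloorFamily f g ν)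
    (hle : ∀ u, g' u ≤ g u) : BudgetFloorFamily f g' ν := by
  obtain ⟨Φ₁, θ₁, hθ₁, hu⟩ := h
  exact ⟨Φ₁, θ₁, hθ₁, fun u => budgetFloorIneq_mono (hu u) (hle u)⟩

/-- **Dropping the tax**: a taxed floor family with `κ ≥ 0` is X's floor family (same multiplier). -/
theorem floorFamily_of_taxed {ν : ℝ} {f : Vec3} {ε₁ κ : ℝ} (hκ : 0 ≤ κ)
    (h : BudgetFloorFamily f (taxBudget ε₁ κ) ν) : FloorFamily f ε₁ ν := by
  obtain ⟨Φ₁, θ₁, hθ₁, hu⟩ := budgetFloorFamily_mono h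
    (g' := fun _ => ε₁) (fun u => by simp only [taxBudget]; nlinarith [sq_nonneg ‖u‖])
  exact ⟨Φ₁, θ₁, hθ₁, hu⟩

/-- **The cubic entrance**: a cubic-budget floor family is a taxed floor family, by stub B. -/
theorem taxed_of_cubic {ε₀ β : ℝ} (hε₀ : 0 < ε₀) (hβ : 0 < β) :
    ∃ ε₁ κ : ℝ, 0 < ε₁ ∧ 0 < κ ∧ ∀ (f : Vec3) (ν : ℝ),
      BudgetFloorFamily f (cubicBudget ε₀ β) ν → BudgetFloorFamily f (taxBudget ε₁ κ) ν := by
  obtain ⟨ε₁, κ, hε₁, hκ, hle⟩ := landed_budgetAlgebra ε₀ β hε₀ hβ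
  exact ⟨ε₁, κ, hε₁, hκ, fun f ν h => budgetFloorFamily_mono h fun u => hle ‖u‖ (norm_nonneg _)⟩

/-- `CubicCertificate → TaxedCertificate` (stub B). -/
theorem taxedCertificate_of_cubic (h : CubicCertificate) : TaxedCertificate := by
  obtain ⟨f, hfs, hfd, hfz, ε₀, β, ν₀, hε₀, hβ, hν₀, hcert⟩ := h
  obtain ⟨ε₁, κ, hε₁, hκ, himp⟩ := taxed_of_cubic hε₀ hβ
  exact ⟨f, hfs, hfd, hfz, ε₁, κ, ν₀, hε₁, hκ, hν₀, fun ν hν hνlt => himp f ν (hcert ν hν hνlt)⟩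

/-- **Weak duality with budget over FMRT statistics** (stub A fed the tree facts): a budget-`g` floor
family at `(f, ν)` (`ν > 0`, `f ∈ L²`) gives `∫ g dμ ≤ ε(μ)` for every stationary statistical solution
`μ` of `NS_ν(f)` under which `g` is integrable. -/
theorem integral_budget_le_ensembleDissipation {ν : ℝ} (hν : 0 < ν) {f : Vec3} (hf : MemLp f 2 volume)
    {g : H3 → ℝ} (hfl : BudgetFloorFamily f g ν) {μ : Measure H3}
    (hμ : Torus.IsStationaryStatisticalSolution ν f μ) (hg : Integrable g μ) :
    ∫ u, g u ∂μ ≤ Torus.ensembleDissipation ν μ := by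
  obtain ⟨Φ₁, θ₁, hθ₁, hfloor⟩ := hfl
  have hball : ∀ᵐ u ∂μ, ‖u‖ ^ 2 ≤ 16 * (∫ x, ‖f x‖ ^ 2) / ν ^ 2 := by
    filter_upwards [hμ.ae_norm_le hν hf] with u hu
    exact ball_of_norm_le hν hf hu
  exact landed_weakDualityBudget ν f Φ₁ θ₁ g μ hθ₁ hfloor hμ.prob hball hμ.enstrophy_finite
    (hμ.generator Φ₁).1 (hμ.generator Φ₁).2 (hμ.integrable_pairing hf)
    (Torus.IsStationaryStatisticalSolution.energy_le_holds hμ hf) hg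

/-- The friction algebra: `κ a² ≤ e ≤ F a`, `a ≥ 0`, `κ > 0` force `a² ≤ (F/κ)²`
(= `SketchIdeator2.sq_le_of_friction`). -/
theorem sq_le_of_friction {κ a F e : ℝ} (hκ : 0 < κ) (ha : 0 ≤ a) (hF : 0 ≤ F)
    (h1 : κ * a ^ 2 ≤ e) (h2 : e ≤ F * a) : a ^ 2 ≤ (F / κ) ^ 2 := by
  have h3 : κ * a ^ 2 ≤ F * a := le_trans h1 h2
  have h4 : a ≤ F / κ := by
    rw [le_div_iff₀ hκ]
    rcases eq_or_lt_of_le ha with h0 | hpos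
    · rw [← h0]; simp; positivity
    · nlinarith
  exact pow_le_pow_left₀ ha h4 2

/-- **The ENSEMBLE CEILING from a taxed floor** (stub A + the injection bound): under a taxed floor
family at `(f, ν)` with `κ > 0`, every stationary statistical solution of `NS_ν(f)` with integrable
energy has `e(μ) ≤ (‖f‖₂/κ)²`. -/
theorem ensembleEnergy_le_of_taxed {ν : ℝ} (hν : 0 < ν) {f : Vec3} (hf : MemLp f 2 volume) {ε₁ κ : ℝ}
    (hε₁ : 0 ≤ ε₁) (hκ : 0 < κ) (hfl : BudgetFloorFamily f (taxBudget ε₁ κ) ν) {μ : Measure H3}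
    (hμ : Torus.IsStationaryStatisticalSolution ν f μ) (hint : Integrable (fun v : H3 => ‖v‖ ^ 2) μ) :
    Torus.ensembleEnergy μ ≤ (Real.sqrt (∫ x, ‖f x‖ ^ 2) / κ) ^ 2 := by
  haveI := hμ.prob
  have hg : Integrable (taxBudget ε₁ κ) μ := (integrable_const ε₁).add (hint.const_mul κ)
  have hA := integral_budget_le_ensembleDissipation hν hf hfl hμ hg
  have hsplit : ∫ u, taxBudget ε₁ κ u ∂μ = ε₁ + κ * Torus.ensembleEnergy μ := by
    simp only [taxBudget]
    rw [integral_add (integrable_const ε₁) (hint.const_mul κ), integral_const_mul]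
    simp [Torus.ensembleEnergy]
  rw [hsplit] at hA
  have hI := Torus.ensembleDissipation_le_of_isStationary_holds hμ hf hint
  have hEnn : 0 ≤ Torus.ensembleEnergy μ := integral_nonneg fun v => by positivity
  set a : ℝ := Real.sqrt (Torus.ensembleEnergy μ) with ha_def
  have ha : 0 ≤ a := Real.sqrt_nonneg _
  have ha2 : a ^ 2 = Torus.ensembleEnergy μ := Real.sq_sqrt hEnn
  have h1 : κ * a ^ 2 ≤ Torus.ensembleDissipation ν μ := by rw [ha2]; linarith
  have := sq_le_of_friction hκ ha (Real.sqrt_nonneg _) h1 hI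
  rwa [ha2] at this

/-! ## The certificate entrances to X (stubs A, B): taxed and cubic -/

/-- **X from a taxed certificate** (the line's species; kernel-checked, no `sorry` beyond stub A — LANDED):
take the force `f` and `(ε₁, κ, ν₀)` and answer X with `(f, ε₁, (‖f‖₂/κ)², ν₀)`; the taxed floor family
with the tax dropped IS the floor block of X (same `Φ₁ = Ψ`, `θ₁ = α`), and every stationary
statistical solution with integrable energy obeys the ceiling by `ensembleEnergy_le_of_taxed`. -/
theorem floorCertificateEnsembleCeiling_of_taxed (h : TaxedCertificate) : FloorCertificateEnsembleCeiling := by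
  obtain ⟨f, hfs, hfd, hfz, ε₁, κ, ν₀, hε₁, hκ, hν₀, hcert⟩ := h
  have hf : MemLp f 2 volume := hfs.memLp 2
  refine ⟨f, hfs, hfd, hfz, ε₁, (Real.sqrt (∫ x, ‖f x‖ ^ 2) / κ) ^ 2, ν₀, hε₁, hν₀, fun ν hν hνlt => ?_⟩
  have hT := hcert ν hν hνlt
  obtain ⟨Φ₁, θ₁, hθ₁, hfloor⟩ := floorFamily_of_taxed hκ.le hT
  exact ⟨⟨Φ₁, θ₁, hθ₁, fun u => hfloor u⟩,
    fun μ hμ hint => ensembleEnergy_le_of_taxed hν hf hε₁.le hκ hT hμ hint⟩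

/-- The cubic entrance to X (card `cubic-budget-certificate`, = `SketchIdeator1.x_of_cubicCertificate`
with its sorry discharged by stubs A and B). -/
theorem floorCertificateEnsembleCeiling_of_cubic (h : CubicCertificate) : FloorCertificateEnsembleCeiling :=
  floorCertificateEnsembleCeiling_of_taxed (taxedCertificate_of_cubic h)

/-! ## What a taxed certificate delivers on atoms (stub E folded): the κ-census anchor -/

/-- Under a taxed floor family at `(f, ν)`, every steady weak solution `u ∈ V` of `NS_ν(f)` is
`ε₁`-loud and `κ`-damped: `ε₁ + κ|u|² ≤ ν‖∇u‖² = (u,f) ≤ |u| ‖f‖₂`; in particular `|u| ≤ ‖f‖₂/κ`. -/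
theorem steady_taxed_pinch {ν : ℝ} (hν : 0 < ν) {f : Vec3} (hf : MemLp f 2 volume) {ε₁ κ : ℝ}
    (hε₁ : 0 ≤ ε₁) (hκ : 0 < κ) (hfl : BudgetFloorFamily f (taxBudget ε₁ κ) ν) {u : H3}
    (hV : (u : L2) ∈ Torus.energySpaceV (Fin 3)) (hu : Torus.IsSteadyWeakSolution ν f u) :
    ε₁ + κ * ‖u‖ ^ 2 ≤ ν * (Torus.eGradNormSq ((u : L2) : Vec3)).toReal ∧ ‖u‖ ≤ ‖hf.toLp f‖ / κ := by
  obtain ⟨Ψ, α, -, hfloor⟩ := hfl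
  obtain ⟨h1, h2, h3⟩ := landed_steadyTaxed ν f hf Ψ α ε₁ κ u hν hfloor hV hu
  refine ⟨h1, ?_⟩
  rw [le_div_iff₀ hκ]
  have h4 : κ * ‖u‖ ^ 2 ≤ ‖u‖ * ‖hf.toLp f‖ := by linarith
  rcases eq_or_lt_of_le (norm_nonneg u) with h0 | hpos
  · rw [← h0]; simp
  · nlinarith

/-! ## Taxed certificates ⇔ uniform relaxed pinning (stubs A, G; Ky Fan = stub F) -/

/-- **RELAXED STATIONARY STATISTIC** of `NS_ν(f)` on the Leray ball (verbatim the sibling line's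
`Cruxes/FloorCertificate/Lines/dissipation-deficit-duality.IsRelaxedStatistic`, not yet landed anywhere
importable): a Borel probability measure on `H` carried by the Leray ball, of finite mean enstrophy,
annihilating every cylindrical Liouville functional, with integrable work and the ONE global mean energy
inequality. The exact dual class of X's constant-weight certificates (Disproof §H R2). -/
def IsRelaxedStatistic (ν : ℝ) (f : Vec3) (μ : Measure H3) : Prop :=
  IsProbabilityMeasure μ ∧
    (∀ᵐ u ∂μ, ‖u‖ ^ 2 ≤ 16 * (∫ x, ‖f x‖ ^ 2) / ν ^ 2) ∧
    Torus.ensembleEnstrophy μ < ⊤ ∧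
    (∀ Φ : Torus.CylindricalTest (Fin 3),
      Integrable (fun u => Torus.nsGeneratorPairing ν f u (Φ.grad u)) μ ∧
        ∫ u, Torus.nsGeneratorPairing ν f u (Φ.grad u) ∂μ = 0) ∧
    Integrable (fun u : H3 => Torus.pairing (u : L2) f) μ ∧
    Torus.ensembleDissipation ν μ ≤ ∫ u, Torus.pairing (u : L2) f ∂μ

/-- **UNIFORM RELAXED PINNING** of a force `f` — the ensemble form of stub C AT `f`: constants
`ε₁, κ, ν₀ > 0` such that every relaxed stationary statistic of `NS_ν(f)`, `ν ∈ (0, ν₀)`, obeys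
`ε₁ + κ e(μ) ≤ ε(μ)` (uniformly LOUD and uniformly DAMPED: a ν-independent effective friction rate). -/
def UniformRelaxedPinning (f : Vec3) : Prop :=
  ∃ ε₁ κ ν₀ : ℝ, 0 < ε₁ ∧ 0 < κ ∧ 0 < ν₀ ∧ ∀ ν : ℝ, 0 < ν → ν < ν₀ →
    ∀ μ : Measure H3, IsRelaxedStatistic ν f μ →
      ε₁ + κ * Torus.ensembleEnergy μ ≤ Torus.ensembleDissipation ν μ

/-- Ky Fan's convex-like minimax principle (Fan 1953, Thm 2; γ-form) — the content of stub F, named. -/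
def FanMinimax : Prop :=
  ∀ (X Y : Type) [TopologicalSpace X] [CompactSpace X] [Nonempty Y] (φ : X → Y → ℝ),
    (∀ y : Y, LowerSemicontinuous fun x : X => φ x y) →
    (∀ (x₁ x₂ : X) (t : ℝ), 0 ≤ t → t ≤ 1 → ∃ x₀ : X, ∀ y : Y, φ x₀ y ≤ t * φ x₁ y + (1 - t) * φ x₂ y) →
    (∀ (y₁ y₂ : Y) (t : ℝ), 0 ≤ t → t ≤ 1 → ∃ y₀ : Y, ∀ x : X, t * φ x y₁ + (1 - t) * φ x y₂ ≤ φ x y₀) →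
    ∀ γ : ℝ, (∀ x : X, ∃ y : Y, γ < φ x y) → ∃ y : Y, ∀ x : X, γ < φ x y

/-- Under a probability measure carried by a ball the energy `‖u‖²` is integrable. -/
theorem integrable_norm_sq_of_ball {μ : Measure H3} [IsProbabilityMeasure μ] {ρ : ℝ}
    (hball : ∀ᵐ u ∂μ, ‖u‖ ^ 2 ≤ ρ) : Integrable (fun u : H3 => ‖u‖ ^ 2) μ := by
  refine Integrable.mono' (integrable_const ρ) (continuous_norm.pow 2).aestronglyMeasurable ?_
  filter_upwards [hball] with u hu
  rw [Real.norm_of_nonneg (sq_nonneg _)]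
  exact hu

/-- The mean of the tax budget: `∫ (ε₁ + κ|u|²) dμ = ε₁ + κ e(μ)`. -/
theorem integral_taxBudget (ε₁ κ : ℝ) {μ : Measure H3} [IsProbabilityMeasure μ]
    (hint : Integrable (fun u : H3 => ‖u‖ ^ 2) μ) :
    ∫ u, taxBudget ε₁ κ u ∂μ = ε₁ + κ * Torus.ensembleEnergy μ := by
  simp only [taxBudget]
  rw [integral_add (integrable_const ε₁) (hint.const_mul κ), integral_const_mul]
  simp [Torus.ensembleEnergy]

/-- **C at `f` ⇒ uniform relaxed pinning of `f`** (weak duality, stub A over the relaxed class; same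
constants). -/
theorem uniformRelaxedPinning_of_taxed {f : Vec3} {ε₁ κ ν₀ : ℝ} (hε₁ : 0 < ε₁) (hκ : 0 < κ)
    (hν₀ : 0 < ν₀) (h : ∀ ν : ℝ, 0 < ν → ν < ν₀ → BudgetFloorFamily f (taxBudget ε₁ κ) ν) :
    UniformRelaxedPinning f := by
  refine ⟨ε₁, κ, ν₀, hε₁, hκ, hν₀, fun ν hν hνlt μ hμ => ?_⟩
  obtain ⟨Φ₁, θ₁, hθ₁, hfloor⟩ := h ν hν hνlt
  obtain ⟨hprob, hball, hZ, hLiou, hB, hE⟩ := hμ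
  haveI := hprob
  have hint : Integrable (fun u : H3 => ‖u‖ ^ 2) μ := integrable_norm_sq_of_ball hball
  have hg : Integrable (taxBudget ε₁ κ) μ := (integrable_const ε₁).add (hint.const_mul κ)
  have hA := landed_weakDualityBudget ν f Φ₁ θ₁ (taxBudget ε₁ κ) μ hθ₁ hfloor hprob hball hZ
    (hLiou Φ₁).1 (hLiou Φ₁).2 hB hE hg
  rwa [integral_taxBudget ε₁ κ hint] at hA

/-- **Uniform relaxed pinning of `f` ⇒ C at `f`** (strong duality with budget, stub G, fed the LANDED
sibling stubs S0 `stub_lscEnstrophy`, S1 `stub_sublevelCompact`, S3a `stub_cylindricalCombination` and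
the hypothesis S2 = `FanMinimax`); constants `(ε₁/4, κ, ν₀)`. Run G at `ν` with budget
`g = ε₁/2 + κ|u|²` and slack `η = ε₁/4`: every relaxed statistic has `∫g dμ + η = 3ε₁/4 + κe ≤ ε₁ + κe ≤ ε`. -/
theorem taxed_of_uniformRelaxedPinning (hS2 : FanMinimax) {f : Vec3} (hfs : Torus.IsSmooth f)
    (h : UniformRelaxedPinning f) :
    ∃ ε₁ κ ν₀ : ℝ, 0 < ε₁ ∧ 0 < κ ∧ 0 < ν₀ ∧
      ∀ ν : ℝ, 0 < ν → ν < ν₀ → BudgetFloorFamily f (taxBudget ε₁ κ) ν := by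
  obtain ⟨ε₁, κ, ν₀, hε₁, hκ, hν₀, hpin⟩ := h
  refine ⟨ε₁ / 4, κ, ν₀, by positivity, hκ, hν₀, fun ν hν hνlt => ?_⟩
  have hgc : Continuous (taxBudget (ε₁ / 2) κ) :=
    continuous_const.add (continuous_const.mul (continuous_norm.pow 2))
  have hgK : ∃ K : ℝ, ∀ u : H3, |taxBudget (ε₁ / 2) κ u| ≤ K * (1 + ‖u‖ ^ 2) := by
    refine ⟨ε₁ / 2 + κ, fun u => ?_⟩
    simp only [taxBudget]
    rw [abs_of_nonneg (by positivity)]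
    nlinarith [sq_nonneg ‖u‖, hε₁, hκ]
  have hhyp : ∀ μ : Measure H3, IsProbabilityMeasure μ →
      (∀ᵐ u ∂μ, ‖u‖ ^ 2 ≤ 16 * (∫ x, ‖f x‖ ^ 2) / ν ^ 2) → Torus.ensembleEnstrophy μ < ⊤ →
      (∀ Φ : Torus.CylindricalTest (Fin 3),
        Integrable (fun u => Torus.nsGeneratorPairing ν f u (Φ.grad u)) μ ∧
          ∫ u, Torus.nsGeneratorPairing ν f u (Φ.grad u) ∂μ = 0) →
      Integrable (fun u : H3 => Torus.pairing (u : L2) f) μ →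
      Torus.ensembleDissipation ν μ ≤ ∫ u, Torus.pairing (u : L2) f ∂μ →
      (∫ u, taxBudget (ε₁ / 2) κ u ∂μ) + ε₁ / 4 ≤ Torus.ensembleDissipation ν μ := by
    intro μ hprob hball hZ hLiou hB hE
    haveI := hprob
    have hint : Integrable (fun u : H3 => ‖u‖ ^ 2) μ := integrable_norm_sq_of_ball hball
    rw [integral_taxBudget (ε₁ / 2) κ hint]
    have := hpin ν hν hνlt μ ⟨hprob, hball, hZ, hLiou, hB, hE⟩
    linarith
  obtain ⟨Φ, θ, hθ, hfloor⟩ := landed_budgetDuality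
    Theorems.TaylorCertificatesFloorCertificate.stub_lscEnstrophy
    (Theorems.TaylorCertificatesFloorCertificate.stub_sublevelCompact
      Theorems.TaylorCertificatesFloorCertificate.stub_lscEnstrophy)
    hS2 Theorems.TaylorCertificatesFloorCertificate.stub_cylindricalCombination
    ν f hν hfs (taxBudget (ε₁ / 2) κ) hgc hgK (ε₁ / 4) (by positivity) hhyp
  refine ⟨Φ, θ, hθ, fun u hfin hball => ?_⟩
  have h1 := hfloor u hfin hball
  simp only [taxBudget] at h1 ⊢
  linarith

/-- **THE REDUCTION (modulo Ky Fan): C ⇔ some admissible force is uniformly relaxed-pinned.** -/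
theorem taxedCertificate_iff_pinning (hS2 : FanMinimax) :
    TaxedCertificate ↔
      ∃ f : Vec3, Torus.IsSmooth f ∧ Torus.IsDivFree f ∧ Torus.HasZeroMean f ∧ UniformRelaxedPinning f := by
  constructor
  · rintro ⟨f, hfs, hfd, hfz, ε₁, κ, ν₀, hε₁, hκ, hν₀, h⟩
    exact ⟨f, hfs, hfd, hfz, uniformRelaxedPinning_of_taxed hε₁ hκ hν₀ h⟩
  · rintro ⟨f, hfs, hfd, hfz, h⟩
    obtain ⟨ε₁, κ, ν₀, hε₁, hκ, hν₀, hT⟩ := taxed_of_uniformRelaxedPinning hS2 hfs h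
    exact ⟨f, hfs, hfd, hfz, ε₁, κ, ν₀, hε₁, hκ, hν₀, hT⟩

/-- **FMRT ⊂ RELAXED**: every stationary statistical solution of `NS_ν(f)` (`ν > 0`, `f ∈ L²`) is a
relaxed stationary statistic on the Leray ball. -/
theorem isRelaxedStatistic_of_isStationary {ν : ℝ} (hν : 0 < ν) {f : Vec3} (hf : MemLp f 2 volume)
    {μ : Measure H3} (hμ : Torus.IsStationaryStatisticalSolution ν f μ) : IsRelaxedStatistic ν f μ := by
  refine ⟨hμ.prob, ?_, hμ.enstrophy_finite, hμ.generator, hμ.integrable_pairing hf, ?_⟩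
  · filter_upwards [hμ.ae_norm_le hν hf] with u hu
    exact ball_of_norm_le hν hf hu
  · exact Torus.IsStationaryStatisticalSolution.energy_le_holds hμ hf

/-- **Pinning splits into X's two dual halves over the relaxed class**: a uniformly pinned force has a
uniform relaxed dissipation FLOOR `ε ≥ ε₁` and a uniform relaxed energy CEILING `e ≤ (‖f‖₂/κ)²`
(injection bound for the relaxed class: `ε ≤ ∫(u,f) ≤ ‖f‖₂ √e`, Cauchy–Schwarz twice). -/
theorem floor_and_ceiling_of_pinning {f : Vec3} (hf : MemLp f 2 volume) (h : UniformRelaxedPinning f) :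
    ∃ ε₁ E ν₀ : ℝ, 0 < ε₁ ∧ 0 < ν₀ ∧ ∀ ν : ℝ, 0 < ν → ν < ν₀ → ∀ μ : Measure H3, IsRelaxedStatistic ν f μ →
      ε₁ ≤ Torus.ensembleDissipation ν μ ∧ Torus.ensembleEnergy μ ≤ E := by
  obtain ⟨ε₁, κ, ν₀, hε₁, hκ, hν₀, hpin⟩ := h
  refine ⟨ε₁, (‖hf.toLp f‖ / κ) ^ 2, ν₀, hε₁, hν₀, fun ν hν hνlt μ hμ => ?_⟩
  have hp := hpin ν hν hνlt μ hμ
  obtain ⟨hprob, hball, -, -, hB, hE⟩ := hμ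
  haveI := hprob
  have hint : Integrable (fun u : H3 => ‖u‖ ^ 2) μ := integrable_norm_sq_of_ball hball
  have he0 : 0 ≤ Torus.ensembleEnergy μ := integral_nonneg fun u => by positivity
  refine ⟨by nlinarith, ?_⟩
  -- injection bound over the relaxed class: `ε ≤ ∫(u,f) ≤ ‖f‖ ∫‖u‖ ≤ ‖f‖ √e`
  have hW : ∫ u, Torus.pairing (u : L2) f ∂μ ≤ ‖hf.toLp f‖ * Real.sqrt (Torus.ensembleEnergy μ) := by
    have hnorm : Integrable (fun u : H3 => ‖u‖) μ := by
      refine Integrable.mono' ((integrable_const (1 : ℝ)).add hint) continuous_norm.aestronglyMeasurable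
        (ae_of_all _ fun u => ?_)
      rw [Real.norm_of_nonneg (norm_nonneg _), Pi.add_apply]
      nlinarith [norm_nonneg u, sq_nonneg (‖u‖ - 1)]
    have h1 : ∫ u, Torus.pairing (u : L2) f ∂μ ≤ ∫ u : H3, ‖hf.toLp f‖ * ‖u‖ ∂μ := by
      refine integral_mono hB (hnorm.const_mul _) fun u => ?_
      have := Torus.abs_pairing_coe_le hf u
      rw [mul_comm] at this
      exact (le_abs_self _).trans this
    rw [integral_const_mul] at h1
    have h2 : ∫ u : H3, ‖u‖ ∂μ ≤ Real.sqrt (Torus.ensembleEnergy μ) :=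
      Torus.integral_le_sqrt_integral_sq (ae_of_all _ fun u => norm_nonneg u)
        continuous_norm.aestronglyMeasurable hint
    exact h1.trans (mul_le_mul_of_nonneg_left h2 (norm_nonneg _))
  set a : ℝ := Real.sqrt (Torus.ensembleEnergy μ) with ha_def
  have ha : 0 ≤ a := Real.sqrt_nonneg _
  have ha2 : a ^ 2 = Torus.ensembleEnergy μ := Real.sq_sqrt he0
  have hk : κ * a ^ 2 ≤ Torus.ensembleDissipation ν μ := by rw [ha2]; linarith
  have := sq_le_of_friction hκ ha (norm_nonneg _) hk (hE.trans hW)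
  rwa [ha2] at this

/-- Stub F folded: Ky Fan's minimax principle. -/
theorem fanMinimax : FanMinimax := landed_fanMinimax

/-! ## The DUAL PAIR of a force and the composition: X from stub C by strong duality (S0 S1 S3a S3 S4 landed + F) -/

/-- The UNIFORM RELAXED FLOOR of a force (clause (i) of stub C): below `ν₀` every relaxed stationary
statistic of `NS_ν(f)` on the Leray ball dissipates at least `ε₀` in the mean. -/
def UniformRelaxedFloor (f : Vec3) (ε₀ ν₀ : ℝ) : Prop :=
  ∀ ν : ℝ, 0 < ν → ν < ν₀ → ∀ μ : Measure H3, IsRelaxedStatistic ν f μ → ε₀ ≤ Torus.ensembleDissipation ν μ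

/-- The UNIFORM FMRT CEILING of a force (clause (ii) of stub C, = X's ceiling clause verbatim): below `ν₀`
every stationary statistical solution of `NS_ν(f)` with integrable energy has mean energy `≤ E`. -/
def UniformCeiling (f : Vec3) (E ν₀ : ℝ) : Prop :=
  ∀ ν : ℝ, 0 < ν → ν < ν₀ → ∀ μ : Measure H3, Torus.IsStationaryStatisticalSolution ν f μ →
    Integrable (fun v : H3 => ‖v‖ ^ 2) μ → Torus.ensembleEnergy μ ≤ E

/-- `DualPair`: stub C folded — one admissible force with a uniform relaxed floor and a uniform FMRT ceiling. -/
def DualPair : Prop :=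
  ∃ f : Vec3, Torus.IsSmooth f ∧ Torus.IsDivFree f ∧ Torus.HasZeroMean f ∧
    ∃ ε₀ E ν₀ : ℝ, 0 < ε₀ ∧ 0 < ν₀ ∧ UniformRelaxedFloor f ε₀ ν₀ ∧ UniformCeiling f E ν₀

/-- Stub C folded into the vocabulary (currying the conjunction `IsRelaxedStatistic`). -/
theorem dualPair : DualPair := by
  obtain ⟨f, hfs, hfd, hfz, ε₀, E, ν₀, hε₀, hν₀, h⟩ := stub_dualPair
  exact ⟨f, hfs, hfd, hfz, ε₀, E, ν₀, hε₀, hν₀,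
    fun ν hν hνlt μ hμ => (h ν hν hνlt).1 μ hμ.1 hμ.2.1 hμ.2.2.1 hμ.2.2.2.1 hμ.2.2.2.2.1 hμ.2.2.2.2.2,
    fun ν hν hνlt μ hμ hint => (h ν hν hνlt).2 μ hμ hint⟩

/-- **`(L, M)`-APPROXIMATELY RELAXED STATISTIC** (verbatim the sibling `IsApproxRelaxed`; the second horn
of `stub_minimaxAlternative` and the input of `stub_penalisationLimit`, both LANDED next door). -/
def IsApproxRelaxed (ν : ℝ) (f : Vec3) (L M : ℝ) (μ : Measure H3) : Prop :=
  IsProbabilityMeasure μ ∧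
    (∀ᵐ u ∂μ, ‖u‖ ^ 2 ≤ 16 * (∫ x, ‖f x‖ ^ 2) / ν ^ 2) ∧
    Torus.ensembleEnstrophy μ < ⊤ ∧
    Integrable (fun u : H3 => Torus.pairing (u : L2) f) μ ∧
    (∀ Φ : Torus.CylindricalTest (Fin 3), Integrable (fun u => Torus.nsGeneratorPairing ν f u (Φ.grad u)) μ) ∧
    Torus.ensembleDissipation ν μ ≤ M ∧
    ∀ (Φ : Torus.CylindricalTest (Fin 3)) (θ : ℝ), -L ≤ θ → θ ≤ 0 →
      (∀ u : H3, ‖u‖ ^ 2 ≤ 16 * (∫ x, ‖f x‖ ^ 2) / ν ^ 2 → |Torus.nsGeneratorPairing ν f u (Φ.grad u)| ≤ L) →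
      Torus.ensembleDissipation ν μ + ∫ u, Torus.nsGeneratorPairing ν f u (Φ.grad u) ∂μ +
          2 * θ * ((∫ u, Torus.pairing (u : L2) f ∂μ) - Torus.ensembleDissipation ν μ) ≤ M

/-- The minimax alternative (LANDED `TaylorCertificatesFloorCertificate.stub_minimaxAlternative`, fed the
LANDED S0 `stub_lscEnstrophy`, S1 `stub_sublevelCompact`, S3a `stub_cylindricalCombination` and stub F). -/
theorem minimaxAlternative {ν : ℝ} {f : Vec3} (hν : 0 < ν) (hfs : Torus.IsSmooth f) (L γ η : ℝ)
    (hL : 0 ≤ L) (hη : 0 < η) :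
    (∃ (Φ : Torus.CylindricalTest (Fin 3)) (θ : ℝ), -L ≤ θ ∧ θ ≤ 0 ∧
        (∀ u : H3, ‖u‖ ^ 2 ≤ 16 * (∫ x, ‖f x‖ ^ 2) / ν ^ 2 → |Torus.nsGeneratorPairing ν f u (Φ.grad u)| ≤ L) ∧
        ∀ u : H3, FloorIneq ν f Φ θ (γ - η) u) ∨
      ∃ μ : Measure H3, IsApproxRelaxed ν f L (γ + η) μ :=
  Theorems.TaylorCertificatesFloorCertificate.stub_minimaxAlternative
    Theorems.TaylorCertificatesFloorCertificate.stub_lscEnstrophy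
    (Theorems.TaylorCertificatesFloorCertificate.stub_sublevelCompact
      Theorems.TaylorCertificatesFloorCertificate.stub_lscEnstrophy)
    fanMinimax Theorems.TaylorCertificatesFloorCertificate.stub_cylindricalCombination ν f hν hfs L γ η hL hη

/-- The penalisation limit (LANDED `TaylorCertificatesFloorCertificate.stub_penalisationLimit`, fed S0, S1, S3a). -/
theorem penalisationLimit {ν : ℝ} {f : Vec3} (hν : 0 < ν) (hfs : Torus.IsSmooth f) (M : ℝ)
    (μs : ℕ → Measure H3) (hμs : ∀ n : ℕ, IsApproxRelaxed ν f n M (μs n)) :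
    ∃ μ : Measure H3, IsRelaxedStatistic ν f μ ∧ Torus.ensembleDissipation ν μ ≤ M :=
  Theorems.TaylorCertificatesFloorCertificate.stub_penalisationLimit
    Theorems.TaylorCertificatesFloorCertificate.stub_lscEnstrophy
    (Theorems.TaylorCertificatesFloorCertificate.stub_sublevelCompact
      Theorems.TaylorCertificatesFloorCertificate.stub_lscEnstrophy)
    Theorems.TaylorCertificatesFloorCertificate.stub_cylindricalCombination ν f hν hfs M μs hμs

/-- Floors are monotone in the (constant) budget. -/
theorem floorIneq_mono' {ν : ℝ} {f : Vec3} {Φ : Torus.CylindricalTest (Fin 3)} {θ ε ε' : ℝ} {u : H3}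
    (h : FloorIneq ν f Φ θ ε u) (hle : ε' ≤ ε) : FloorIneq ν f Φ θ ε' u :=
  fun h1 h2 => hle.trans (h h1 h2)

/-- **STRONG DUALITY FOR THE FLOOR at one viscosity (modulo stub F).** If every relaxed stationary
statistic of `NS_ν(f)` dissipates at least `ε₀` then a floor family with budget `ε₀/2` exists at `ν`:
otherwise, for every `n` the alternative at `(L, γ, η) = (n, 3ε₀/4, ε₀/8)` cannot take its first horn
(a floor family with budget `5ε₀/8`), so it yields `(n, 7ε₀/8)`-approximately relaxed statistics, whose
penalisation limit is a relaxed statistic with `ε ≤ 7ε₀/8 < ε₀` (= the mooted sibling composition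
`FloorCertificate_of`, re-proved here at fixed `ν`). -/
theorem floorFamily_of_relaxedFloor {ν : ℝ} {f : Vec3} (hν : 0 < ν) (hfs : Torus.IsSmooth f) {ε₀ : ℝ}
    (hε₀ : 0 < ε₀) (hloud : ∀ μ : Measure H3, IsRelaxedStatistic ν f μ → ε₀ ≤ Torus.ensembleDissipation ν μ) :
    FloorFamily f (ε₀ / 2) ν := by
  by_contra hno
  have hB : ∀ n : ℕ, ∃ μ : Measure H3, IsApproxRelaxed ν f n (3 * ε₀ / 4 + ε₀ / 8) μ := by
    intro n
    rcases minimaxAlternative hν hfs n (3 * ε₀ / 4) (ε₀ / 8) (Nat.cast_nonneg n) (by positivity) with hA | hB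
    · obtain ⟨Φ, θ, -, hθ0, -, hfloor⟩ := hA
      exact absurd ⟨Φ, θ, hθ0, fun u => floorIneq_mono' (hfloor u) (by linarith)⟩ hno
    · exact hB
  choose μs hμs using hB
  obtain ⟨μ, hrel, hdiss⟩ := penalisationLimit hν hfs _ μs hμs
  have h := hloud μ hrel
  linarith

/-- **`FloorCertificateEnsembleCeiling` from the stubs (kernel-checked; no `sorry` of its own).** Take the
force and `(ε₀, E, ν₀)` of stub C and answer X with `(f, ε₀/2, E, ν₀)`: at `ν ∈ (0, ν₀)` the uniform
relaxed floor gives a floor family with budget `ε₀/2` by strong duality (stub T1 = `floorFamily_of_relaxedFloor`: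
landed sibling S0/S1/S2/S3a/S3/S4), and the ceiling clause is clause (ii) of C verbatim. -/
theorem FloorCertificateEnsembleCeiling_of : FloorCertificateEnsembleCeiling := by
  obtain ⟨f, hfs, hfd, hfz, ε₀, E, ν₀, hε₀, hν₀, h⟩ := stub_dualPair
  refine ⟨f, hfs, hfd, hfz, ε₀ / 2, E, ν₀, half_pos hε₀, hν₀, fun ν hν hνlt => ?_⟩
  obtain ⟨hfloor, hceil⟩ := h ν hν hνlt
  obtain ⟨Φ₁, θ₁, hθ₁, hfl⟩ := stub_floorOfRelaxedFloor ν f ε₀ hν hfs hε₀ hfloor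
  exact ⟨⟨Φ₁, θ₁, hθ₁, fun u => hfl u⟩, fun μ hμ hint => hceil μ hμ hint⟩

/-- The same composition through the in-file proof of T1 (`floorFamily_of_relaxedFloor`), kept as the
kernel-checked source the T1 worker copies; identical content. -/
theorem floorCertificateEnsembleCeiling_of_dualPair (h : DualPair) : FloorCertificateEnsembleCeiling := by
  obtain ⟨f, hfs, hfd, hfz, ε₀, E, ν₀, hε₀, hν₀, hfloor, hceil⟩ := h
  refine ⟨f, hfs, hfd, hfz, ε₀ / 2, E, ν₀, half_pos hε₀, hν₀, fun ν hν hνlt => ?_⟩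
  obtain ⟨Φ₁, θ₁, hθ₁, hfl⟩ := floorFamily_of_relaxedFloor hν hfs hε₀ (hfloor ν hν hνlt)
  exact ⟨⟨Φ₁, θ₁, hθ₁, fun u => hfl u⟩, fun μ hμ hint => hceil ν hν hνlt μ hμ hint⟩

/-! ## Exactness: stub C is NECESSARY for X; the certificate species imply it -/

/-- **WEAK DUALITY for the relaxed class** (stub A with a constant budget): a floor family for
`(f, ε, ν)` makes every relaxed stationary statistic of `NS_ν(f)` `ε`-loud. -/
theorem relaxed_loud_of_floorFamily {ν : ℝ} {f : Vec3} {ε : ℝ} (hfl : FloorFamily f ε ν) {μ : Measure H3}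
    (hμ : IsRelaxedStatistic ν f μ) : ε ≤ Torus.ensembleDissipation ν μ := by
  obtain ⟨Φ₁, θ₁, hθ₁, hfloor⟩ := hfl
  obtain ⟨hprob, hball, hZ, hLiou, hB, hE⟩ := hμ
  haveI := hprob
  have h := landed_weakDualityBudget ν f Φ₁ θ₁ (fun _ => ε) μ hθ₁ hfloor hprob hball hZ (hLiou Φ₁).1
    (hLiou Φ₁).2 hB hE (integrable_const ε)
  simpa using h

/-- **X ⇒ stub C** (exactness): the floor clause of X makes every relaxed statistic `ε₀`-loud by weak
duality, and the ceiling clause of X is clause (ii) of C. So C is X's exact dual: necessary outright,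
sufficient modulo Ky Fan. -/
theorem dualPair_of_target (h : FloorCertificateEnsembleCeiling) : DualPair := by
  obtain ⟨f, hfs, hfd, hfz, ε₀, E, ν₀, hε₀, hν₀, hX⟩ := h
  refine ⟨f, hfs, hfd, hfz, ε₀, E, ν₀, hε₀, hν₀, fun ν hν hνlt μ hμ => ?_, fun ν hν hνlt μ hμ hint => ?_⟩
  · obtain ⟨⟨Φ₁, θ₁, hθ₁, hfloor⟩, -⟩ := hX ν hν hνlt
    exact relaxed_loud_of_floorFamily ⟨Φ₁, θ₁, hθ₁, fun u => hfloor u⟩ hμ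
  · exact (hX ν hν hνlt).2 μ hμ hint

/-- **The certificate species implies stub C** (stub A): a taxed certificate for `f` pins every relaxed
statistic (`ε ≥ ε₁ + κe ≥ ε₁`) and caps every FMRT energy at `(‖f‖₂/κ)²`. -/
theorem dualPair_of_taxed (h : TaxedCertificate) : DualPair := by
  obtain ⟨f, hfs, hfd, hfz, ε₁, κ, ν₀, hε₁, hκ, hν₀, hcert⟩ := h
  have hf : MemLp f 2 volume := hfs.memLp 2
  refine ⟨f, hfs, hfd, hfz, ε₁, (Real.sqrt (∫ x, ‖f x‖ ^ 2) / κ) ^ 2, ν₀, hε₁, hν₀,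
    fun ν hν hνlt μ hμ => ?_, fun ν hν hνlt μ hμ hint => ?_⟩
  · obtain ⟨hprob, hball, hZ, hLiou, hB, hE⟩ := hμ
    haveI := hprob
    obtain ⟨Φ₁, θ₁, hθ₁, hfloor⟩ := hcert ν hν hνlt
    have hint : Integrable (fun u : H3 => ‖u‖ ^ 2) μ := integrable_norm_sq_of_ball hball
    have hg : Integrable (taxBudget ε₁ κ) μ := (integrable_const ε₁).add (hint.const_mul κ)
    have hA := landed_weakDualityBudget ν f Φ₁ θ₁ (taxBudget ε₁ κ) μ hθ₁ hfloor hprob hball hZ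
      (hLiou Φ₁).1 (hLiou Φ₁).2 hB hE hg
    rw [integral_taxBudget ε₁ κ hint] at hA
    have he0 : 0 ≤ Torus.ensembleEnergy μ := integral_nonneg fun u => by positivity
    nlinarith [mul_nonneg hκ.le he0]
  · exact ensembleEnergy_le_of_taxed hν hf hε₁.le hκ (hcert ν hν hνlt) hμ hint

/-- **X ↔ DualPair** (the content of stub T4, proved in-file: `dualPair_of_target` + `floorCertificateEnsembleCeiling_of_dualPair`). -/
theorem target_iff_dualPair : FloorCertificateEnsembleCeiling ↔ DualPair :=
  ⟨dualPair_of_target, floorCertificateEnsembleCeiling_of_dualPair⟩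

/-- Stub T4 folded: the registered (unbundled) form agrees with `target_iff_dualPair`. -/
theorem target_iff_dualPair' :
    FloorCertificateEnsembleCeiling ↔
      ∃ f : Vec3, Torus.IsSmooth f ∧ Torus.IsDivFree f ∧ Torus.HasZeroMean f ∧
        ∃ ε₀ E ν₀ : ℝ, 0 < ε₀ ∧ 0 < ν₀ ∧ UniformRelaxedFloor f ε₀ ν₀ ∧ UniformCeiling f E ν₀ := by
  rw [stub_targetIffDualPair]
  constructor
  · rintro ⟨f, hfs, hfd, hfz, ε₀, E, ν₀, hε₀, hν₀, h⟩
    exact ⟨f, hfs, hfd, hfz, ε₀, E, ν₀, hε₀, hν₀,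
      fun ν hν hνlt μ hμ => (h ν hν hνlt).1 μ hμ.1 hμ.2.1 hμ.2.2.1 hμ.2.2.2.1 hμ.2.2.2.2.1 hμ.2.2.2.2.2,
      fun ν hν hνlt μ hμ hint => (h ν hν hνlt).2 μ hμ hint⟩
  · rintro ⟨f, hfs, hfd, hfz, ε₀, E, ν₀, hε₀, hν₀, hfl, hce⟩
    exact ⟨f, hfs, hfd, hfz, ε₀, E, ν₀, hε₀, hν₀, fun ν hν hνlt =>
      ⟨fun μ h1 h2 h3 h4 h5 h6 => hfl ν hν hνlt μ ⟨h1, h2, h3, h4, h5, h6⟩, fun μ hμ hint => hce ν hν hνlt μ hμ hint⟩⟩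

end Summit.AnomalousDissipation.AnomalousDissipation.Cruxes.FloorCertificateEnsembleCeiling.Sketch

end
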